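import Summits.QuantumFields.YangMills.Theses.BalabanUVNodes
import Summits.QuantumFields.YangMills.Theorems.BalabanUVNodesPortS1JacGlue
import Summits.QuantumFields.YangMills.Theorems.BalabanUVNodesPortRecordRepresentationS1StubLZjacKStep
import Summits.QuantumFields.YangMills.Theorems.BalabanUVNodesPortRecordRepresentationS1StubLZjacDom
import Summits.QuantumFields.YangMills.Theorems.BalabanUVNodesK0RecordFormatNamesP0CGuardedL
import Summits.QuantumFields.YangMills.Theorems.BalabanUVNodesPortS1G3CDefsL
import Summits.QuantumFields.YangMills.Theorems.BalabanUVNodesPortRecordRepresentationS1StubLZdetTwin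
import Summits.QuantumFields.YangMills.Theorems.BalabanUVNodesPortS1LZdetGlue
import Summits.QuantumFields.YangMills.Theorems.BalabanUVNodesPortS1BoxEditions
import Summits.QuantumFields.YangMills.Theorems.BalabanUVNodesPortS1FEInductionByName
import Summits.QuantumFields.YangMills.Theorems.BalabanUVNodesPortS1FEStepConverse
import Summits.QuantumFields.YangMills.Theorems.BalabanUVNodesPortS1FEStepReg
import Summits.QuantumFields.YangMills.Theorems.BalabanUVNodesPortS1FEStepPieces

/-!
# Skeleton of record for the crux `PortRecordRepresentationS1` — stmt-QuantumFields-27930 (⁸-Ax-LR4 `12934e3fd231d69a`), line `pta-residueW`, v3.8 = v3.7 WITH ONE RE-POINT (★★★ director-ym g24 №634 (1)(3) (the `FEStepReg` SUB-SPLIT = BRICK OF RECORD + HOIST; v3.8 gated on a census + the hoist ✓), №636 (2) (census verdict (b) ADOPTED: NO `Sel` re-key; v3.8 WORDING FIXED),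
# №637 (1)(e) (`stub_LZhalfReg` stays ONE stub — the LZ-side class letters are NOT promoted, 8 > 7) and the PEN word №638, 2026-08-31T19:22Z; pen by the plan owner ✦ pub-ymgap-plan g104 after its ADMISSIBILITY CENSUS (nodeO l.6155) and
# ★★ DEF-1 g39's hoist ✓p831837 `…PortS1FEStepPieces` (eebd961f2f4ba51e · 214 l.; ◇ lens-1 g15's located v21 sub-split, kernel-checked glue), customs ◆ CRIT-1 g40): `stub_FEstepReg : ∀ F, FEStepReg F` ↦ THE FOUR PIECES
# {`stub_FEchartLawReg : ∀ F, FEChartLawReg F` (S₁, XL), `stub_regClassNestsUc : ∀ F, RegClassNestsUc F` (S₂, M; SHARED with ▶ PT-A's LZ brick), `stub_FEpolymerActivitiesReg : ∀ F, FEPolymerActivitiesReg F` (S₃, XXL = NODE O proper),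
# `stub_FEpolymerResummation : ∀ F, FEPolymerResummation F` (S₄, M–L, NO Bałaban antecedent)}: the old stub's statement `∀ F, FEStepReg F` is a THEOREM MODULO {`stub_P0C`, the four} — ✓`feStepReg_of_polymerPieces` — kept below as the
# sorry-free `feStepReg_of_stubs`; the composition `PortRecordRepresentationS1_of` is RE-COMPOSED exactly as at v3.7 (same landed chain ✓`PortRecordRepresentationS1_of_step` ∘ ✓`feStepBox_of_feHalfBox` ∘ ✓`portRecordFEHalfBox_of_reg`)
# with its `FEStepReg` slot fed by ✓`feStepReg_of_polymerPieces`, so it takes the SEVEN registered statements (`<Crux>_of : stub₁ → … → stub₇ → Crux`, every hypothesis a declared stub); NO `Sel` re-key (the crux is itself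
# bare-`recordΦfAx`-keyed; the ✓`…K0RecordFormatNamesAxSel` names serve the supplier side inside S₃ ∕ S₄ proofs); every other declaration of v3.7 is byte-identical; v3.7 = v3.6 WITH ONE RE-POINT (★★★ director-ym g24 №625 (v3.7 YES under the decision rule of №623, after ◆ CRIT-1 g40's BC3 customs PASS on the pair, nodeO l.6046), 2026-08-31T17:55:14Z;
# pen by the plan owner ✦ pub-ymgap-plan g103 (on standby per №623), customs ◆ CRIT-1 g40 (ONE per-stub BC3 pass on the pair)): `stub_FEstep : ∀ F, FEStepBox F` ↦ THE (ε₀)-CLASS PAIR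
# {`stub_LZhalfReg : ∀ F, PortRecordLZHalfReg F`, `stub_FEstepReg : ∀ F, FEStepReg F`} (porter hand `hand-27930-FE-1` g0: ✓p830062 `…PortS1FEStepReg` v2 `bb1e29df8441b93e` + ✓p829504 `…PortS1FEStepConverse`):
# the old stub's statement `∀ F, FEStepBox F` is a THEOREM MODULO the pair — ✓`portRecordFEHalfBox_of_reg` (the near-`0` ε₀-regularity of the charted datum being the THEOREM ✓`eventually_inRegClass`,
# the [15] Thm 1 token taken at `ε₁ := min a₁ (a₀∕B₃)`) followed by ✓`feStepBox_of_feHalfBox` — and the composition below is RE-COMPOSED through that chain into ✓`PortRecordRepresentationS1_of_step`;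
# every other declaration of v3.6 is byte-identical; v3.6 = v3.5 WITH ONE RE-POINT (★★★ director-ym g23 №613 (1), 2026-08-31T17:00:07Z;
# pen by the plan owner ✦ pub-ymgap-plan g103, customs ◆ CRIT-1 g39): `stub_FE : ∀ F, PortRecordFEHalfBox F` ↦ `stub_FEstep : ∀ F, FEStepBox F` — THE INDUCTIVE STEP of the fluctuation-expansion half
# in GERM currency (porter hand `hand-27930-FE-1` g0: ✓p828902 `…PortS1FEInduction` + ✓`…PortS1FEInductionByName`): the old stub's statement `∀ F, PortRecordFEHalfBox F` is a THEOREM MODULO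
# {`stub_P0C`, `stub_G3C`'s statement, `FEStepBox`} — ✓`stub_FE_of_step` (strong induction on the scale ✓`feResidueBoxAt_all_of_step`, the LZ half ✓`lzHalf_of_lzjac_GL`, the δ-Jacobian sub-half ✓`lzjacHalf_all`) —
# and the composition below is RE-COMPOSED from ✓`PortRecordRepresentationS1_of_step`; every other declaration of v3.5 is byte-identical; v3.5 = v3.4 (★★★ director-ym №565∕№566: FOUR RE-POINTS —
# `stub_P0C : ∀ F, P0HolExtAtRecordGL F` (the GUARDED L-EDITION of the P0-ℂ letter, ✓ DEF-1 `…P0CGuardedL`), `stub_G3C : ∀ F, G3CAtRecordL F` (the REPAIRED located gap G-P6 over the lattice-decay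
# body, ✓ hand-27930-G3C `…PortS1G3CDefsL`), `stub_LZdetGlue : ∀ F, P0HolExtAtRecordGL F → G3CAtRecordL F → PortRecordLZdetHalf F`, `stub_FE : ∀ F, PortRecordFEHalfBox F` (the BOX EDITION, ✓ ★ P3 №11
# `…PortS1BoxEditions`, Box ⟹ Runs by ✓`portRecordFEHalf_of_box`) — WITH the lead's reshape (L4) of the glue CLOSED: the registered stub `stub_LZdetTwin : ∀ F, PowMemberIntTwin F` (the integer twin of the (63) power member) IS A LANDED THEOREM
# (gen 8 ✓`…PortS1LZdetTwinBridge.powMemberIntTwin_holds`, by name ✓`…PortRecordRepresentationS1StubLZdetTwin`) and so `stub_LZdetGlue` IS A THEOREM OUTRIGHT (✓`…PortS1LZdetGlue.lzdetHalf_of_twin_GL`);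
# the δ-Jacobian stubs `stub_LZjacDom` ∕ `stub_LZjacKStep` are LANDED THEOREMS; OPEN at v3.6: `stub_P0C`, `stub_G3C`, `stub_FEstep`; OPEN at v3.7: `stub_P0C`, `stub_G3C`, `stub_LZhalfReg`, `stub_FEstepReg`; OPEN at v3.8: `stub_P0C`, `stub_G3C` (closed BY NAME ✓p824985 on the ledger), `stub_LZhalfReg`, `stub_FEchartLawReg`, `stub_regClassNestsUc`,
# `stub_FEpolymerActivitiesReg`, `stub_FEpolymerResummation` — all letters of other lanes)

Route `BalabanUVNodes` (route-QuantumFields-BalabanUVNodes; sub-problem `YangMills`; rank-9 support row «port (S1)»).  Lead: porter lineage `ymgap-nodeO-port-PTA-1` (gen 4 registered the two-stub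
skeleton {`stub_LZ`, `stub_FE`}; gen 5 split `stub_LZ` into {`stub_LZjac`, `stub_LZdet`}; gen 6 proved everything of `stub_LZjac` except its analytic rows (a)(b), displayed them as `JacRowsAB F`, and split `JacRowsAB` into its two halves `JacRowsABDom` ∕ `JacKStep` glued by the
exact `SL(2,ℂ)`-gauge invariance of `J_T` (`…JacKStepGlue.jacRowsAB_of_kstep_of_dom`); gen 7 proved `stub_LZjacDom` by LOCALIZING porter PTZ-1's one-step rows to the component block
`jacBlockCt` (polydisc hypothesis at `c` only: `…JacDomLocal`, `…JacDomLocalDet`) and assembling the tower (`…JacDomTower.jacRowsABDom_holds`: det-one propagation up the saturated tower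
region by splicing, `W`-level locality of `jacFactorCt` via the cover bridge, dag-n12-c's tower analyticity, `a := 1∕(5168·576·L⁴)`, `E := 2`)).
[I] = Bałaban CMP 109 (1987) = `Balaban1987RG1`; [II] = CMP 116 (1988) = `Balaban1988RG2Cluster`; [15] = CMP 102 (1985) = `Balaban1985Variational`; [16] = CMP 102 (1985) = `Balaban1985UV3`.

THE LINE.  Print (2.12) p.268 splits the step functional as `[log Z^{(k)}(U_{k+1}) − log Z^{(k)}(1)] + [fluctuation bracket]`; (1.4) p.260 + p.268 split `log Z^{(k)}` once more into the δ-JACOBIAN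
bracket `−Σ_c log|det A₁(c)|` and the GAUSSIAN bracket `−½ log det (C_locᵀ Δ^{(k)} C_loc)`; Thm 3's format for each bracket separately gives it for the sum (`…HalvesJacGlue.sig27930v8LR4_of_three`,
✓p812279).  GEN 6 (files `…PortS1Jac*`, all ✓): the δ-Jacobian bracket IS in Thm 3's format MODULO ITS ANALYTIC ROWS — the integer formula `Ψ_jac` of the universal cover (`ΨjacRaw`,
✓p814190) is window-local (`isLocal_ΨjacRaw` ✓p814447) and `SL(2,ℂ)`-invariant as a total function (`isGaugeInv_ΨjacRaw` ✓p814868: componentwise `fderiv`, trace-projected coordinates,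
`fderiv` conjugated through linear equivalences unconditionally); its cover pull-backs are the torus pieces `E_T` off the centred wrap class (`ΨjacRaw_intCubes_pullPair` ✓p815904, the
bijection `ĉ ↦ π ĉ`); `E_T` satisfies (c)(d) (`localOnW_∕gaugeInvOnW_jacTorusPieces` ✓p815553); and `phiLZjac` IS REPRESENTED near `B = 0` (`representsW_phiLZjac` ✓p816006: on the germ
`log|det A₁(c)(V^{(k)}_{ax}(W_B))| = J_T(c, ↑U_{k+1}(W_B))`).  Rows (a)(b) on and off the wrap class follow from the per-bond analytic rows `JacRowsAB F` (✓ `…JacRowsDefs`) with `E₁ = 8 Mc⁴ E e^κ`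
(`…JacTorusRows` §2, `…JacOffWrap`); glue `…JacGlue.lzjacHalf_of_jacRowsAB : JacRowsAB F → PortRecordLZjacHalf F`; and `JacRowsAB F` itself follows from its two halves
(`…JacKStepDefs`): the complex-domain rows `JacRowsABDom F` at tower-loop-small `SL(2,ℂ)` fields and the `k`-step reading `JacKStep F` of the record space (`…JacKStepGlue.jacRowsAB_of_kstep_of_dom`,
by `jacTorus_cAct` and the analyticity of the action on pairs; the `det` clause of the reading ✓ `…JacKStepReading`).

GEN 8 (files `…PortS1LZdet*`, all ✓): the porter's glue of the Gaussian bracket IS PROVED — geometry (`…LZdetGeom`: `recordUc_anti` (C-2), cube map, per-cube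
count), row (a) (`…LZdetPiecesAnalytic`: dominated parameter integral + Osgood + normally convergent (63) power series), germ membership (`…LZdetGermMem`), rows (b)(c)(d) (gen 7 `…LZdetPiecesBound` ∕
`…LocGauge`), the (63) germ identity (gen 7 `…LZdetGerm`), assembly at fixed carriers (`…LZdetAssembly.lzdetResidue_of_carriers`, `E₁ = 2·13·4⁴(R·Bc + 12(L·Mc)⁴)`, `κ = min κt (δ₀∕2) − 2`) and the
letter-level walk (`…LZdetGlue.lzdetHalf_of_twin_GL`), and the integer twin of the power member (`…LocPowTransport`, `…LZdetTwinObjects∕Local∕Lift∕GeomK∕Bridge`: transport of the (63) power series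
along the centred lift off the wrap class, ★★★ `powMemberIntTwin_holds`).

STUBS (`sorry`s ONLY in `stub_P0C`, `stub_G3C`, `stub_LZhalfReg`, `stub_FEchartLawReg`, `stub_regClassNestsUc`, `stub_FEpolymerActivitiesReg`, `stub_FEpolymerResummation` — v3.8; `stub_FEstepReg`'s statement is the
sorry-free-through-the-stubs theorem `feStepReg_of_stubs`; `stub_LZdetTwin`, `stub_LZdetGlue` and the two δ-Jacobian stubs are THEOREMS):
* `stub_LZjacDom : ∀ F, JacRowsABDom F` — ✓ PROVED (gen 7, `…JacDomTower.jacRowsABDom_holds`).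
* `stub_LZjacKStep : ∀ F, JacKStep F` — ✓ PROVED (gen 6, p817566).
* `stub_P0C : ∀ F, P0HolExtAtRecordGL F` — THE P0-ℂ LETTER, guarded L-edition (+ the (G-b) TokE guard after `0 < a₀ →`, + (P4-lat) `P0CarrierLatticeDecay` = unit-lattice Schur decay
  of the carrier pieces, [B9] (3.42) ∕ [15] (190)) ([15] Prop. 9 ∕ Thm 1 (E2) at the record's (2.11) carrier, k-uniform): a complex total carrier `TC = Σ_Y TY` on the non-b₀ fluctuation
  index with its integer twin `TZY` (support ∕ domain-indexing ∕ window-locality ∕ blockwise `SL(2,ℂ)`-covariance ∕ cover bridge off the wrap class), germ agreement with `recordPreckLoc ∘ portVkAx`,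
  piecewise covariance, (1.7) locality, analyticity on the record spaces with SCHUR row∕column decay `c₀e^{−δ₀ dj Y}`, real-germ `PosDef` + two-sided spectral bounds, complex coercivity of the
  X-localized partial sums — quantifier prefix ◆ CRIT-1 g37 (`∃ c₀ γ₀ γ₁, ∀ δ₀, ∃ Mth, ∀ Mc ≥ Mth, McGuard → ∀ a₀, ∃ α₀ α₁, ∀ ε₂₉ k, ∃ carriers, P0CarrierClauses …`).  P0-CLASS · L; supplier =
  node00-def-Y's complex minimiser scheme (M2-ℂ).  DISPLAYED, inhabited nowhere.
* `stub_G3C : ∀ F, G3CAtRecordL F` — THE LOCATED GAP G-P6 (repaired cut, hand-27930-G3C ∕ №565: body `P0CarrierClauses → P0CarrierLatticeDecay → ∃ EG EGZ, G3CPiecesAt`): for every target rate `κt`, every carrier satisfying the P0-ℂ body + (P4-lat) with `δ₀ ≥ δG`, `Mc ≥ Mth'` has the RESUMMED random-walk pieces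
  `G3CPiecesAt` of `Tr (x + T)⁻¹` ((g1) trace identity at the germ, x-pointwise on `[0,∞)`; holomorphy + x-uniform bound `Bc·#X·e^{−κt dj X}` + x-continuity on an open set ⊇ record space;
  locality; invariance; one integer formula) — the complex ∕ field-localised ∕ torus edition of [B4] (5.17) + [B9] (3.90) + [16] p.272.  GENUINE · L–XL (N∕B9 lane).
* `stub_LZdetTwin : ∀ F, PowMemberIntTwin F` — THE INTEGER TWIN OF THE (63) POWER MEMBER: ✓ PROVED (gen 8, `…LZdetTwinBridge.powMemberIntTwin_holds`; by name `…StubLZdetTwin`).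
* `stub_LZdetGlue : ∀ F, P0HolExtAtRecordGL F → G3CAtRecordL F → PortRecordLZdetHalf F` — THE PORTER's GLUE: ✓ PROVED OUTRIGHT (gen 8, ✓`…PortS1LZdetGlue.lzdetHalf_of_twin_GL` + `stub_LZdetTwin`:
  (63) on `[0, R]` at the germ, the power members localized ∕ analytic ∕ bounded, the resolvent member from `stub_G3C`, unit subtraction, germ membership, integer twin, packaging ✓`…LZdetPack.residueAtW_of_piecesJ`).
* `stub_LZhalfReg : ∀ F, PortRecordLZHalfReg F` — THE LZ HALF, ε₀-CLASS EDITION (v3.7 re-point; letter ✓`…PortS1FEStepReg` :140): under the ⁸ antecedent (verbatim `PortRecordFEHalfBox`'s), for EVERY (2.9)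
  radius `ε₂₉ > 0` k-UNIFORM `E₁ κ α₀ α₁ δ₀` with the LZ residue at every level in the CLASS format `LZResidueRegAt` (`ResidueOnRegAtW … δ₀`: the (f′)-row identity ON `InRegClass` =
  `UkExists ∧ recordBgField ∈ bgReg δ₀`, not merely eventually at `B = 0`).  WHY NOT A THEOREM ALREADY (named): the GERM edition `PortRecordLZHalf` IS a theorem modulo `stub_P0C` ∕ `stub_G3C`
  (✓`lzHalf_of_lzjac_GL`); the class edition needs the P0-ℂ letter's (P2) germ-agreement row `recordPreckLoc ∘ portVkAx` WIDENED from the germ to the ε₀-class (★★★ №615 (1): ONE (P2)-widening row;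
  `stub_P0C`'s type UNTOUCHED) — located, P0-class; whether it sits inside ▶ PTA-1's P0C supply road or is a separable M-piece is ▶ PTA-1's ONE line at decision time (№623).  OPEN; inhabited nowhere.
* `stub_FEstepReg : ∀ F, FEStepReg F` — RE-POINTED AT v3.8 (no longer a stub: a THEOREM modulo `stub_P0C` + the four pieces below by ✓`feStepReg_of_polymerPieces`, kept as `feStepReg_of_stubs`) —
  THE INDUCTIVE STEP of the fluctuation-expansion half ON PRINT's DOMAIN (v3.7 re-point; letter ✓`…PortS1FEStepReg` :135 = ✓`FEStepBox` with
  `ResidueAtW ↦ ResidueOnRegAtW … ε₀`, the LZ package's class radius `δ₀` and FE's `ε₀` displayed, positive, k-uniform): under the ⁸ antecedent FE picks `ε₂₉ > 0`; for EVERY class-format LZ package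
  `(E₁, κ₁, β₀, β₁, δ₀)` there are k-UNIFORM `γ₀ E₂ κ α₀ α₁ ε₀` such that for every `k` the class-format FE residues on the box at all `j < k` imply the class-format FE residue on the box at `k` —
  [I] Thm 3 at scale `k+1` from (1.7)+(1.18)+(1.19) at scales `≤ k` ON `U(ε₀)` (p.264, p.268 L27–31, (2.12)–(2.14)).  XXL (PRINT-ROAD PT-I = [I] §2–§5 + [II]); inhabited nowhere.
  v3.6's LOCATED CAVEAT (germ-vs-domain currency) is RETIRED BY NAME here: hypothesis AND conclusion are identities on the displayed ε₀-class, print's (1.1)–(1.2) domain reading; the germ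
  edition `FEStepBox` follows from the pair (✓`portRecordFEHalfBox_of_reg` → ✓`feStepBox_of_feHalfBox`); the `Uc` edition ✓`…PortS1FEStepUc` (`FEStepUc`, `CutsInUcNear` a theorem) stays a landed
  letter beside it, not registered.  DISPLAYED DOOR OF RECORD (★★★ №620, NOT discharged, docstring-carried): for `k ≥ 1` the step PRESUPPOSES the normalisation `hinv` (N-0) = verbatim the
  hypothesis of ✓`recordΦfAx_apply_zero_of_eq` (`…PortS1RecordPhiAxZero`, p829790: `A_k(Ū^k(U_{k+1}(1))) = A_k(1)` for `TβOfRecord₁₃` ∕ `χAx` ∕ `extd v`), ⟺ regular-set membership of the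
  iterated minimisers + a.e. lift-invariance (N09 :127 ∕ :145), whose only producer is N09 :93 `iterUk_mem_regSet_of_supp_of_chiβ13Ax_eq_one` from (N29)ᴬˣ `hχreg` + (F7a)ᴬˣ `hone` at `V = 1`;
  `k = 0` is DISCHARGED (✓`recordΦfAx_zero_scale_at_zero`, `…PortS1FENormalisationZero` p829862); discharger by name for `k ≥ 1` = the lane holding (N29)ᴬˣ ∕ (F7a)ᴬˣ at `V = 1` (▶ PTC-1 to say
  after (A1) ∕ (A1′)); no owner, no socket, no clock until then.
* `stub_FEchartLawReg : ∀ F, FEChartLawReg F` — S₁, FE-1 ε₀-CLASS EDITION (XL; ✓`…PortS1FEStepPieces` :114): under the ⁸ antecedent and the P0-ℂ letter FE picks `εp`; for every `ε₂₉ ≤ εp` a class cap `εc`;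
  for every class-format LZ package and FE constants with `ε₀ ≤ εc`, at every level under the inductive hypothesis, `phiFE = feFluctDiff` ON THE ε₀-CLASS — print's (2.1) ↦ (2.12) second bracket =
  (2.13) minus its value at `U_{k+1} = 1` ([I] (2.1)–(2.9) pp.265–266, (2.10)–(2.14) pp.267–268).  A genuinely WEAKER print consequence than `FEStepReg`.  The (N-0) displayed door of v3.7's
  `stub_FEstepReg` docstring (★★★ №620: the chart law PRESUPPOSES `hinv`) rides HERE in reading; `k = 0` discharged (✓`recordΦfAx_zero_scale_at_zero`); the `UkSel`-keyed unit step (β1) ✓`…PortZDStepUnitSel`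
  is a landed helper (no stub credit).  OPEN (XL); inhabited nowhere.
* `stub_regClassNestsUc : ∀ F, RegClassNestsUc F` — S₂, THE NESTING BRICK (M; ✓`…PortS1FEStepPieces` :123), the (α) edition UNDER the ⁸ antecedent (★★★ №635 (t5) ∕ №636 (1) un-merge; the registry
  DISPLAYS [15] Thm 1 instead of proving it): for every `(ε₂₉, α₀, α₁)` a k-UNIFORM class radius `εn` below which every cut pair of an ε₀-regular charted datum lies in `U^c_{k+1}(X, α₀, α₁)` of record
  ([I] p.263 L5–20, (1.11)–(1.16); [15] Prop. 9 p.309).  SHARED with ▶ PT-A's LZ brick (№637 (1)(c) `…PortS1LZHalfRegL`, which IMPORTS it from the hoist); implied by the STRONGER antecedent-free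
  ✓`ClassNestsUc` (`regClassNestsUc_of_classNestsUc`, via ✓`inRegClass_mono`).  OPEN (M); inhabited nowhere.
* `stub_FEpolymerActivitiesReg : ∀ F, FEPolymerActivitiesReg F` — S₃, THE CLUSTER EXPANSION PROPER (XXL; NODE O proper — THE WALL, UNMOVED; ✓`…PortS1FEStepPieces` :134): under the ⁸ antecedent,
  for every bound `εp` a (2.9) radius `ε₂₉ ≤ εp`; for every class-format LZ package the analyticity sizes `(α₀, α₁)`; for every class cap `εcap` k-UNIFORM `(γ₀, ε₀ ≤ εcap, A, R, E₂, κ)` with the (2.41)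
  numerics at the torus constants, such that at every level `k` the inductive hypothesis at `j < k` yields, for every box history `v`, a W-format activity system `(Hi, Hw)` with `PolymerRepOnRegW … (feFluctDiff … k v)`
  — [I] §3–§5 pp.269–301 + [II] §1, (2.1)–(2.12) p.14, Lemmas 1–3 (2.38) p.20 AT THE RECORD.  Vs `FEStepReg`: NEITHER implies the other (activities, not the resummed residue; ◆ C36).  (f1) PRE-RUN
  PASS (★★★ №636 (2)): `FluctData.newTerm = log ∫ χ·exp(P+Q) dμ` with `μ` normalised by structure, the `½ log det` living in the LZ half ⇒ S₃'s identity row stays as typed.  OPEN (XXL); unstaffed.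
* `stub_FEpolymerResummation : ∀ F, FEPolymerResummation F` — S₄, THE KOTECKÝ–PREISS RESUMMATION AT THE RECORD (M–L; ✓`…PortS1FEStepPieces` :145; NO Bałaban antecedent — takeable now from
  `B13Resummation` + `TreeLengthTorusGeometry.tgeometry` + `ClusterExpansion.exp_polymerLogZ_of_kp`): at ONE level, frame-free, a W-format activity system with the Π-rep rows at `(A, R)`, the (2.41)
  numerics, the class nesting and the ε₀-regularity of `B = 0` give ONE integer-local formula `Ψ` + wrap pieces `Ew` with the seven rows of ✓`ResidueOnRegAtW` at `(E₂, κ)` ([II] (2.12)–(2.13) p.14,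
  (2.39)–(2.41) p.21; [I] (1.7), (1.18)–(1.19)).  Hand `hand-27930-FEresum-1` asked (R729, ★★★ №634 (4)).  OPEN (M–L); inhabited nowhere.

HONEST FRAMING.  A skeleton: seven `sorry`s (stub_P0C, stub_G3C, stub_LZhalfReg, stub_FEchartLawReg, stub_regClassNestsUc, stub_FEpolymerActivitiesReg, stub_FEpolymerResummation — letters of other lanes, `stub_G3C` closed by name on
the ledger, `stub_FEstepReg`'s statement a theorem modulo five of them; stub_LZjacKStep ✓, stub_LZjacDom ✓, stub_LZdetTwin ✓ landed, stub_LZdetGlue ✓ proved — so the WHOLE `log Z^{(k)}` half of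
(2.12) is in Thm 3's format modulo the P0-ℂ letter and the G3C letter) and one composition; nothing of
Bałaban's renormalization-group estimates proved here; 27930 OPEN; NODE O 0∕1; COUNT 8∕28 · K 1∕4 UNMOVED; finite 𝕋⁴ at fixed ε — NOT continuum∕OS∕Clay; the Yang–Mills mass gap is NOT proved by any of this.
-/

namespace Summit.QuantumFields.YangMills.Cruxes.PortRecordRepresentationS1.PtaResidueW

/-! ## The eleven registered stubs — `sorry`s ONLY in `stub_P0C`, `stub_G3C`, `stub_LZhalfReg`, `stub_FEchartLawReg`, `stub_regClassNestsUc`, `stub_FEpolymerActivitiesReg`, `stub_FEpolymerResummation` -/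

/-- Registered stub LZjacDom: rows (a)(b) of the torus Jacobian functional on the tower-loop-small `SL(2,ℂ)` domain ([I] p.267–268 «h(c)», (1.18) p.263), as the landed statement
`JacRowsABDom`. ✓ PROVED (gen 7 — `…JacDomTower.jacRowsABDom_holds`). -/
theorem stub_LZjacDom : ∀ F, Summit.QuantumFields.YangMills.Theorems.BalabanUVNodesPortS1.JacRowsABDom F :=
  Summit.QuantumFields.YangMills.Theorems.BalabanUVNodesPortS1.stub_LZjacDom  -- ✓ LANDED (`…StubLZjacDom`, `…JacDomTower.jacRowsABDom_holds`)

/-- Registered stub LZjacKStep: the `k`-step reading of the record space (1.11)–(1.16), as the landed statement `JacKStep`. ✓ PROVED (gen 6, p817566). -/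
theorem stub_LZjacKStep : ∀ F, Summit.QuantumFields.YangMills.Theorems.BalabanUVNodesPortS1.JacKStep F :=
  Summit.QuantumFields.YangMills.Theorems.BalabanUVNodesPortS1.stub_LZjacKStep  -- ✓ LANDED (p817566, `…JacKStepProof.jacKStep_holds`)

/-- Registered stub P0C (v3.4 re-point): the P0-ℂ letter, guarded L-edition ([15] Prop. 9 ∕ Thm 1 (E2) at the record's (2.11) carrier with unit-lattice decay, k-uniform), as the landed statement
`P0HolExtAtRecordGL`. OPEN · P0-CLASS (supplier: node00-def-Y M2-ℂ). -/
theorem stub_P0C : ∀ F, Summit.QuantumFields.YangMills.Theorems.K0RecordFormatNames.P0HolExtAtRecordGL F := by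
  sorry

/-- Registered stub G3C (v3.4 re-point): the located gap G-P6 over the repaired body — the resummed generalized random walk expansion of `Tr (x + T)⁻¹` at the record's complex localized carrier
with unit-lattice decay ([16] (23)–(25) p.262, p.272; [B9] (3.90)), as the landed statement `G3CAtRecordL`. OPEN · GENUINE (hand-27930-G3C). -/
theorem stub_G3C : ∀ F, Summit.QuantumFields.YangMills.Theorems.BalabanUVNodesPortS1.G3CAtRecordL F := by
  sorry

/-- Registered stub LZdetTwin (v3.4, the lead's reshape of the glue): the integer twin of the (63) power member, as the landed statement `PowMemberIntTwin` ([I] (1.21) p.264 via (1.7) p.261;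
[16] (63) p.272). ✓ PROVED (gen 8 — `…LZdetTwinBridge.powMemberIntTwin_holds`). -/
theorem stub_LZdetTwin : ∀ F, Summit.QuantumFields.YangMills.Theorems.BalabanUVNodesPortS1.PowMemberIntTwin F :=
  Summit.QuantumFields.YangMills.Theorems.BalabanUVNodesPortS1.stub_LZdetTwin  -- ✓ LANDED (`…StubLZdetTwin`, `…LZdetTwinBridge.powMemberIntTwin_holds`)

/-- Registered stub LZdetGlue (v3.4 re-point): the porter's glue — the P0-ℂ letter and the G3C pieces give the Gaussian sub-half `PortRecordLZdetHalf` ([16] (63) on `[0, R]` at the germ, power members localized,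
unit subtraction, packaging). ✓ PROVED (gen 8, `…PortS1LZdetGlue.lzdetHalf_of_twin_GL` + `stub_LZdetTwin`). -/
theorem stub_LZdetGlue : ∀ F, Summit.QuantumFields.YangMills.Theorems.K0RecordFormatNames.P0HolExtAtRecordGL F →
    Summit.QuantumFields.YangMills.Theorems.BalabanUVNodesPortS1.G3CAtRecordL F →
    Summit.QuantumFields.YangMills.Theorems.BalabanUVNodesPortS1.PortRecordLZdetHalf F :=
  fun F hP hG => Summit.QuantumFields.YangMills.Theorems.BalabanUVNodesPortS1.lzdetHalf_of_twin_GL F (stub_LZdetTwin F) hP hG  -- ✓ PROVED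

/-- Registered stub LZhalfReg (v3.7 re-point, ★★★ director-ym g24 №625; with `stub_FEstepReg` it replaces v3.6's `stub_FEstep : ∀ F, FEStepBox F`, which is a THEOREM modulo the pair by
✓`portRecordFEHalfBox_of_reg` → ✓`feStepBox_of_feHalfBox`): THE LZ HALF (`log Z^{(k)}` bracket of (2.12)) in Thm 3's format at every level, ε₀-CLASS EDITION — the (f′)-row identity ON the
displayed class `InRegClass … δ₀` ([I] (1.4) p.260, (1.7) p.261, (1.2) p.260; [16] (63) p.272), as the landed statement `PortRecordLZHalfReg` (✓`…PortS1FEStepReg` :140).  OPEN (located, P0-class: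
the germ edition `PortRecordLZHalf` is a theorem modulo `stub_P0C` ∕ `stub_G3C` by ✓`lzHalf_of_lzjac_GL` ∕ ✓`lzHalf_of_jac_det`, and germ ⇏ class; THE MISSING PIECE (◆ g40 l.6046, hand-FE-1) = the (P2) germ-agreement row `recordPreckLoc ∘ portVkAx` WIDENED from the germ to the δ₀-class — ★★★ №615 (1): ONE (P2)-widening
row, `stub_P0C`'s type untouched; inside ▶ PTA-1's P0C supply road or a separable M-piece per ▶ PTA-1's line at decision time, №623). -/
theorem stub_LZhalfReg : ∀ F, Summit.QuantumFields.YangMills.Theorems.BalabanUVNodesPortS1.PortRecordLZHalfReg F := by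
  sorry

/-- Registered stub FEchartLawReg — S₁ (v3.8 re-point, ★★★ director-ym g24 №634 (1)(3) ∕ №636 (2) ∕ №638; with S₂–S₄ it replaces v3.7's `stub_FEstepReg`, whose statement is a THEOREM modulo `stub_P0C` + the
four by ✓`feStepReg_of_polymerPieces`): FE-1, ε₀-CLASS EDITION — `phiFE = feFluctDiff` on `U_k(ε₀)` under the ⁸ antecedent, the P0-ℂ letter, the class-format LZ package and the inductive hypothesis;
print's (2.1) ↦ (2.12) second bracket ([I] (2.1)–(2.9) pp.265–266, (2.10)–(2.14) pp.267–268), as the landed letter ✓`…PortS1FEStepPieces` :114.  WEAKER than `FEStepReg`.  DISPLAYED DOOR OF RECORD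
(★★★ №620, carried from v3.7's docstring, NOT discharged): for `k ≥ 1` the chart law PRESUPPOSES the normalisation `hinv` (N-0) = verbatim the hypothesis of ✓`recordΦfAx_apply_zero_of_eq`;
`k = 0` DISCHARGED (✓`recordΦfAx_zero_scale_at_zero`); discharger by name for `k ≥ 1` = the lane holding (N29)ᴬˣ ∕ (F7a)ᴬˣ at `V = 1`.  OPEN (XL); inhabited nowhere. -/
theorem stub_FEchartLawReg : ∀ F, Summit.QuantumFields.YangMills.Theorems.BalabanUVNodesPortS1.FEChartLawReg F := by
  sorry

/-- Registered stub regClassNestsUc — S₂ (v3.8 re-point; ★★★ №635 (t5) ∕ №636 (1): the (α) edition UNDER the ⁸ antecedent — the registry DISPLAYS [15] Thm 1 instead of proving it): THE NESTING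
BRICK — for every `(ε₂₉, α₀, α₁)` a k-UNIFORM class radius `εn` below which every cut pair of an ε₀-regular charted datum lies in `U^c_{k+1}(X, α₀, α₁)` of record ([I] p.263 L5–20,
(1.11)–(1.16) pp.262–263; [15] Prop. 9 p.309), as the landed letter ✓`…PortS1FEStepPieces` :123.  SHARED with ▶ PT-A's LZ brick (№637 (1)(c)); implied by the stronger antecedent-free ✓`ClassNestsUc`
(`regClassNestsUc_of_classNestsUc`).  OPEN (M); inhabited nowhere. -/
theorem stub_regClassNestsUc : ∀ F, Summit.QuantumFields.YangMills.Theorems.BalabanUVNodesPortS1.RegClassNestsUc F := by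
  sorry

/-- Registered stub FEpolymerActivitiesReg — S₃ (v3.8 re-point): THE CLUSTER EXPANSION PROPER — NODE O proper, THE WALL, UNMOVED (XXL): under the ⁸ antecedent, `ε₂₉ ≤ εp`, analyticity sizes
`(α₀, α₁)` for every class-format LZ package, then for every class cap k-UNIFORM `(γ₀, ε₀, A, R, E₂, κ)` with the (2.41) numerics at the torus constants such that at every level the inductive
hypothesis yields, for every box history, a W-format polymer activity system with `PolymerRepOnRegW … (feFluctDiff …)` — [I] §3–§5 pp.269–301, (2.13) p.268 + [II] §1, (2.1)–(2.12) p.14,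
Lemmas 1–3 (2.38) p.20 AT THE RECORD, as the landed letter ✓`…PortS1FEStepPieces` :134.  Vs `FEStepReg`: neither implies the other (◆ C36).  (f1) PRE-RUN PASS (№636 (2)).  OPEN (XXL);
unstaffed at pen time; inhabited nowhere. -/
theorem stub_FEpolymerActivitiesReg : ∀ F, Summit.QuantumFields.YangMills.Theorems.BalabanUVNodesPortS1.FEPolymerActivitiesReg F := by
  sorry

/-- Registered stub FEpolymerResummation — S₄ (v3.8 re-point): THE KOTECKÝ–PREISS RESUMMATION AT THE RECORD (M–L; NO Bałaban antecedent — takeable now from `B13Resummation`,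
`TreeLengthTorusGeometry.tgeometry`, `ClusterExpansion.exp_polymerLogZ_of_kp`): at one level, frame-free, a W-format activity system with the Π-rep rows at `(A, R)`, the (2.41) numerics, the
class nesting and the ε₀-regularity of `B = 0` give ONE integer-local formula `Ψ` + wrap pieces `Ew` with the seven rows of ✓`ResidueOnRegAtW` at `(E₂, κ)` ([II] (2.12)–(2.13) p.14,
(2.39)–(2.41) p.21; [I] (1.7) p.261, (1.18)–(1.19) p.263; Kotecký–Preiss Thm 1), as the landed letter ✓`…PortS1FEStepPieces` :145.  Hand `hand-27930-FEresum-1` asked (R729, №634 (4)).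
OPEN (M–L); inhabited nowhere. -/
theorem stub_FEpolymerResummation : ∀ F, Summit.QuantumFields.YangMills.Theorems.BalabanUVNodesPortS1.FEPolymerResummation F := by
  sorry

/-- **`feStepReg_of_stubs`** — v3.7's registered stub `stub_FEstepReg`, RE-POINTED at v3.8 (★★★ №634 (1)(3) ∕ №636 (2) ∕ №638): its statement `∀ F, FEStepReg F` is a THEOREM MODULO `stub_P0C` and the
four pieces S₁–S₄ by ★★ DEF-1's hoisted glue ✓`feStepReg_of_polymerPieces` (✓p831837), sorry-free through the stubs below.  v3.7's reading, kept: THE INDUCTIVE STEP of the fluctuation-expansion half ON THE BOX,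
ON PRINT's DOMAIN — [I] Thm 3 at scale `k+1` from the inductive assumption (1.7)+(1.18)+(1.19) at scales `≤ k` ON `U(ε₀)` ((2.10)–(2.14) p.268 + §3–§5 + [II] Lemmas 1–3 at the record; p.268 L27–31),
as the landed statement `FEStepReg` (✓`…PortS1FEStepReg` :135 = `FEStepBox` with `ResidueAtW ↦ ResidueOnRegAtW … ε₀`, `δ₀` ∕ `ε₀` displayed, positive, k-uniform).  OPEN (XXL; PRINT-ROAD PT-I).
v3.6's LOCATED CAVEAT (germ-vs-domain currency) is RETIRED BY NAME: both sides are identities on the displayed ε₀-class; the germ edition follows (✓`portRecordFEHalfBox_of_reg`, near-`0` regularity =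
the theorem ✓`eventually_inRegClass`; then ✓`feStepBox_of_feHalfBox`).  DISPLAYED DOOR OF RECORD (★★★ №620; NOT discharged; nothing enters the registry for it): for `k ≥ 1` the step PRESUPPOSES the
normalisation door (N-0): the FE-1 chart law presupposes `hinv : Ū^{i+1}(U_{k+1}(1)) ∈ regSetOfRecord … (χAx) …` (for `i+1 < k+1`, + a.e. lift-invariance N09 :127 ∕ :145) = verbatim the
hypothesis of ✓`recordΦfAx_apply_zero_of_eq` (`…PortS1RecordPhiAxZero`: `A_k(Ū^k(U_{k+1}(1))) = A_k(1)`), produced only by N09 :93 `iterUk_mem_regSet_of_supp_of_chiβ13Ax_eq_one` from (N29)ᴬˣ `hχreg` +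
(F7a)ᴬˣ `hone` at `V = 1`; `k = 0` DISCHARGED (✓`recordΦfAx_zero_scale_at_zero`, `…PortS1FENormalisationZero`); discharger by name for `k ≥ 1` = the lane holding (N29)ᴬˣ ∕ (F7a)ᴬˣ at `V = 1`
(▶ PTC-1's line after (A1) ∕ (A1′)).  PROVER NOTE (◆ CRIT-1 g40 customs l.6046): `ε₀` is CHOSEN by the prover after `(a₀, a₁, B₃)` — small `ε₀` puts every class point's `W_B = Ū^{k+1}(U)` inside
`PlaqSmall (C·ε₀)` ⊂ the uniqueness radius of the antecedent's [15] Thm 1 token ([I] p.263 L8–20 «ε₀ sufficiently small»); both class conjuncts (`UkExists`, `∈ bgReg ε₀`) are load-bearing. -/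
theorem feStepReg_of_stubs : ∀ F, Summit.QuantumFields.YangMills.Theorems.BalabanUVNodesPortS1.FEStepReg F :=
  Summit.QuantumFields.YangMills.Theorems.BalabanUVNodesPortS1.feStepReg_of_polymerPieces stub_P0C stub_FEchartLawReg stub_regClassNestsUc stub_FEpolymerActivitiesReg
    stub_FEpolymerResummation  -- a THEOREM modulo the five (✓p831837); no `sorry` here

/-! ## Name-keyed aliases of the stub statements — the hypotheses of `PortRecordRepresentationS1_of` -/
namespace __Registered

/-- Alias of `∀ F, P0HolExtAtRecordGL F` keyed by the registered stub name. -/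
abbrev stub_P0C : Prop := ∀ F, Summit.QuantumFields.YangMills.Theorems.K0RecordFormatNames.P0HolExtAtRecordGL F
/-- Alias of `∀ F, G3CAtRecordL F` keyed by the registered stub name. -/
abbrev stub_G3C : Prop := ∀ F, Summit.QuantumFields.YangMills.Theorems.BalabanUVNodesPortS1.G3CAtRecordL F
/-- Alias of `∀ F, PowMemberIntTwin F` keyed by the registered stub name. -/
abbrev stub_LZdetTwin : Prop := ∀ F, Summit.QuantumFields.YangMills.Theorems.BalabanUVNodesPortS1.PowMemberIntTwin F
/-- Alias of the glue statement keyed by the registered stub name (a THEOREM). -/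
abbrev stub_LZdetGlue : Prop := ∀ F, Summit.QuantumFields.YangMills.Theorems.K0RecordFormatNames.P0HolExtAtRecordGL F →
    Summit.QuantumFields.YangMills.Theorems.BalabanUVNodesPortS1.G3CAtRecordL F →
    Summit.QuantumFields.YangMills.Theorems.BalabanUVNodesPortS1.PortRecordLZdetHalf F
/-- Alias of `∀ F, PortRecordLZHalfReg F` keyed by the registered stub name. -/
abbrev stub_LZhalfReg : Prop := ∀ F, Summit.QuantumFields.YangMills.Theorems.BalabanUVNodesPortS1.PortRecordLZHalfReg F
/-- Alias of `∀ F, FEChartLawReg F` keyed by the registered stub name (S₁). -/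
abbrev stub_FEchartLawReg : Prop := ∀ F, Summit.QuantumFields.YangMills.Theorems.BalabanUVNodesPortS1.FEChartLawReg F
/-- Alias of `∀ F, RegClassNestsUc F` keyed by the registered stub name (S₂). -/
abbrev stub_regClassNestsUc : Prop := ∀ F, Summit.QuantumFields.YangMills.Theorems.BalabanUVNodesPortS1.RegClassNestsUc F
/-- Alias of `∀ F, FEPolymerActivitiesReg F` keyed by the registered stub name (S₃). -/
abbrev stub_FEpolymerActivitiesReg : Prop := ∀ F, Summit.QuantumFields.YangMills.Theorems.BalabanUVNodesPortS1.FEPolymerActivitiesReg F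
/-- Alias of `∀ F, FEPolymerResummation F` keyed by the registered stub name (S₄). -/
abbrev stub_FEpolymerResummation : Prop := ∀ F, Summit.QuantumFields.YangMills.Theorems.BalabanUVNodesPortS1.FEPolymerResummation F

end __Registered

/-! ## Composition: the crux BY NAME from the stub statements (no `sorry` below) -/

/-- **PortRecordRepresentationS1_of** — v3.8: v3.7's composition (the landed ✓`PortRecordRepresentationS1_of_step` — v3.6's; = v3.5's `sig27930v8LR4_of_dom_kstep stub_LZjacDom stub_LZjacKStep
(lzdetHalf_of_twin_GL · (stub_LZdetTwin ·) · ·) (portRecordFEHalf_of_box · ·)` with ✓`stub_FE_of_step` in the FE slot — whose `FEStepBox` argument is SUPPLIED FROM THE (ε₀)-CLASS PAIR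
`fun F => feStepBox_of_feHalfBox (portRecordFEHalfBox_of_reg hLZhalfReg hFEstepReg F)`, ✓`…PortS1FEStepReg` :201 ∕ ✓`…PortS1FEStepConverse` :30) WITH ITS `FEStepReg` SLOT NOW FED BY THE HOISTED GLUE:
`hFEstepReg := feStepReg_of_polymerPieces hP0C hFEchartLawReg hRegClassNestsUc hFEpolymerActivitiesReg hFEpolymerResummation` (✓`…PortS1FEStepPieces` :171, ✓p831837); applied to the OPEN stub statements —
the SEVEN registered ones, every hypothesis a declared stub (`<Crux>_of : stub₁ → … → stub₇ → Crux`); conclusion = the route decl `Summit.QuantumFields.YangMills.Theses.BalabanUVNodes.PortRecordRepresentationS1`, by name. -/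
theorem PortRecordRepresentationS1_of (hP0C : __Registered.stub_P0C) (hG3C : __Registered.stub_G3C)
    (hLZhalfReg : __Registered.stub_LZhalfReg) (hFEchartLawReg : __Registered.stub_FEchartLawReg) (hRegClassNestsUc : __Registered.stub_regClassNestsUc)
    (hFEpolymerActivitiesReg : __Registered.stub_FEpolymerActivitiesReg) (hFEpolymerResummation : __Registered.stub_FEpolymerResummation) :
    Summit.QuantumFields.YangMills.Theses.BalabanUVNodes.PortRecordRepresentationS1 :=
  Summit.QuantumFields.YangMills.Theorems.BalabanUVNodesPortS1.PortRecordRepresentationS1_of_step hP0C hG3C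
    (fun F => Summit.QuantumFields.YangMills.Theorems.BalabanUVNodesPortS1.feStepBox_of_feHalfBox
      (Summit.QuantumFields.YangMills.Theorems.BalabanUVNodesPortS1.portRecordFEHalfBox_of_reg hLZhalfReg
        (Summit.QuantumFields.YangMills.Theorems.BalabanUVNodesPortS1.feStepReg_of_polymerPieces hP0C hFEchartLawReg hRegClassNestsUc hFEpolymerActivitiesReg
          hFEpolymerResummation) F))

/-- The crux from the stubs of THIS file (sorried through them only). -/
theorem PortRecordRepresentationS1_holds_of_stubs :
    Summit.QuantumFields.YangMills.Theses.BalabanUVNodes.PortRecordRepresentationS1 :=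
  PortRecordRepresentationS1_of stub_P0C stub_G3C stub_LZhalfReg stub_FEchartLawReg stub_regClassNestsUc stub_FEpolymerActivitiesReg
    stub_FEpolymerResummation

end Summit.QuantumFields.YangMills.Cruxes.PortRecordRepresentationS1.PtaResidueW
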